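import Mathlib
import Literature.Computability.AlgebraicComplexity.JointCircuits
import Literature.Computability.AlgebraicComplexity.FFTCircuitCost
import HarnessLib

/-!
# Fast power-series arithmetic as circuits: the FFT product tree and Newton iteration for `P^{-1/2}`

Topic `Computability/AlgebraicComplexity`, namespace `Literature.Computability.AlgebraicComplexity`.
Everything PROVED; two bookkeeping definitions (`prodTreeCost`, `newtonCost`: gate counts),
no named facts.

Cost layer, in the tree's circuit model (`complexity`; multi-output bookkeeping by
`JointlyComputed`, `JointCircuits.lean`; fast multiplication `jointlyComputed_lconv`,
`FFTCircuitCost.lean`), of two standard fast algorithms of von zur Gathen–Gerhard,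
*Modern Computer Algebra*, over the ring of circuit nodes `k[X_τ]`:

* `jointlyComputed_prodTree` / `jointlyComputed_prod_linear` (GG §10.1, Algorithm 10.3 /
  Lemma 10.4, "building up the subproduct tree"): ALL coefficients of a product of `n ≤ 2^K`
  linear polynomials over the node ring — e.g. all elementary symmetric polynomials of `n` nodes —
  in `prodTreeCost K ≤ 16 K² 2^K` gates (`prodTreeCost_le`);
* `coeff_newton_rsqrt` (GG §9.1, Newton iteration, for the equation `P y² = 1`): if `ρ² P = 1`
  and `R ≡ ρ (mod X^M)` then `(3R − PR³)/2 ≡ ρ (mod X^{2M})`;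
  `jointlyComputed_newton_step` / `jointlyComputed_newton`: the first `2^J` coefficients of
  `ρ = P^{-1/2}` (`P` a polynomial of degree `≤ N` over the node ring, `ρ(0) = 1`) in
  `newtonCost J ≤ (15 J + 38) 2^{J+1}` gates (`newtonCost_le`), three fast multiplications per
  doubling;
* `jointlyComputed_sum`: a sum of `m + 1` members costs `m` gates.

Hypotheses throughout: scalars `ζ κ` with `(ζ κ)^{2^{κ-1}} = −1` (roots of unity for the
transforms), `tinv κ` with `2^κ · tinv κ = 1`, and `half` with `2 · half = 1` — available in any
field of characteristic `0` containing the `2`-power roots of unity (e.g. `ℂ`).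

## References

* J. von zur Gathen, J. Gerhard, *Modern Computer Algebra*, CUP (3rd ed. 2013), §9.1
  (Newton iteration, Thm 9.2 / Thm 9.4 with fast multiplication), §10.1 (Algorithm 10.3,
  Lemma 10.4: the subproduct tree in `O(M(n) log n)`). [GathenGerhard2013]
* [Burgisser2000] P. Bürgisser, *Completeness and Reduction in Algebraic Complexity Theory*,
  Springer 2000, Def. 2.1 (the circuit model).
-/

noncomputable section

open MvPolynomial

namespace Literature.Computability.AlgebraicComplexity

/-! ### The FFT product tree: all coefficients of a product of `2^K` linear polynomials -/

section ProductTree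

universe uu vv ww

variable {k : Type uu} [CommRing k] {τ : Type vv}

open _root_.Finset _root_.Polynomial

/-- Gate count of the FFT product tree of depth `K` (leaves = linear polynomials): two subtrees
and one fast multiplication with transform length `2^{K+1}` per internal node at depth `K`
(GG §10.1, Algorithm 10.3: `O(M(n) log n)`). [cite: GathenGerhard2013, §10.1 Lemma 10.4] -/
def prodTreeCost : ℕ → ℕ
  | 0 => 0
  | K + 1 => 2 * prodTreeCost K + (3 * K + 8) * 2 ^ (K + 2)

/-- `prodTreeCost K ≤ 16 K² 2^K`. [cite: GathenGerhard2013, §10.1 Lemma 10.4] -/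
theorem prodTreeCost_le (K : ℕ) : prodTreeCost K ≤ 16 * K ^ 2 * 2 ^ K := by
  induction K with
  | zero => simp [prodTreeCost]
  | succ K ih =>
    rw [prodTreeCost]
    have h4 : 2 ^ (K + 2) = 4 * 2 ^ K := by rw [pow_succ, pow_succ]; ring
    have h2 : 2 ^ (K + 1) = 2 * 2 ^ K := by rw [pow_succ]; ring
    rw [h4, h2]
    nlinarith [ih, Nat.zero_le K, Nat.one_le_two_pow (n := K)]

/-- The linear convolution of the coefficient sequences of two polynomials is the coefficient
sequence of their product. [folklore] -/
private theorem lconv_coeff_eq_coeff_mul {S : Type*} [CommSemiring S] (A B : S[X]) (m : ℕ) :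
    lconv (fun i => A.coeff i) (fun j => B.coeff j) m = (A * B).coeff m := by
  rw [Polynomial.coeff_mul]; rfl

/-- **The FFT product tree as a circuit** (GG Algorithm 10.3 / Lemma 10.4, cost part, in
Bürgisser's model): if the two coefficients of each of `2^K` linear polynomials `Q_b` over the
node ring are read off a jointly computed family within `s` gates, then so are ALL `2^K + 1`
coefficients of `∏_b Q_b` within `s + prodTreeCost K ≤ s + 16 K² 2^K` gates, given roots of unity
`ζ κ` (`(ζ κ)^{2^{κ-1}} = −1`) and inverses `tinv κ` of `2^κ` in `k`. Recursion: both halves,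
then one fast multiplication (`jointlyComputed_lconv`) with transform length `2^{K+2}`.
[cite: GathenGerhard2013, §10.1 Lemma 10.4] -/
theorem jointlyComputed_prodTree (ζ tinv : ℕ → k)
    (hζ : ∀ κ, κ ≠ 0 → ζ κ ^ 2 ^ (κ - 1) = -1) (ht : ∀ κ, (2 ^ κ : k) * tinv κ = 1) :
    ∀ (K : ℕ) {ι : Type ww} (v : ι → MvPolynomial τ k) (s : ℕ)
      (Q : Fin (2 ^ K) → (MvPolynomial τ k)[X]) (e₀ e₁ : Fin (2 ^ K) → ι),
      JointlyComputed v s → (∀ b, (Q b).natDegree ≤ 1) →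
      (∀ b, v (e₀ b) = (Q b).coeff 0) → (∀ b, v (e₁ b) = (Q b).coeff 1) →
      JointlyComputed (Sum.elim v (fun m : Fin (2 ^ K + 1) => (∏ b, Q b).coeff m))
        (s + prodTreeCost K)
  | 0, ι, v, s, Q, e₀, e₁, hv, hdeg, h₀, h₁ => by
    rw [prodTreeCost, Nat.add_zero]
    refine hv.of_mem _ ?_
    rintro (i | m)
    · exact Or.inl ⟨i, rfl⟩
    · refine Or.inl ?_
      have h10 : (1 : ℕ) = 2 ^ 0 := by norm_num
      have hprod : (∏ b : Fin (2 ^ 0), Q b) = Q 0 := by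
        rw [← Fintype.prod_equiv (finCongr h10) (fun b => Q (finCongr h10 b)) Q (fun _ => rfl),
          Fin.prod_univ_one]
        exact congrArg Q (Fin.ext rfl)
      simp only [Sum.elim_inr]
      rw [hprod]
      rcases Nat.lt_or_ge (m : ℕ) 1 with hm | hm
      · exact ⟨e₀ 0, by rw [h₀, show (m : ℕ) = 0 by omega]⟩
      · exact ⟨e₁ 0, by rw [h₁, show (m : ℕ) = 1 by have := m.isLt; simp at this; omega]⟩
  | K + 1, ι, v, s, Q, e₀, e₁, hv, hdeg, h₀, h₁ => by
    have hlen : 2 ^ (K + 1) = 2 ^ K + 2 ^ K := by rw [pow_succ, mul_two]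
    let lo : Fin (2 ^ K) → Fin (2 ^ (K + 1)) := fun b => ⟨b, by omega⟩
    let hi : Fin (2 ^ K) → Fin (2 ^ (K + 1)) := fun b => ⟨2 ^ K + b, by omega⟩
    set A : (MvPolynomial τ k)[X] := ∏ b, Q (lo b) with hA
    set B : (MvPolynomial τ k)[X] := ∏ b, Q (hi b) with hB
    have hprod : (∏ b, Q b) = A * B := by
      rw [hA, hB, ← Fintype.prod_equiv (finCongr hlen).symm (fun b => Q ((finCongr hlen).symm b))
        (fun b => Q b) (fun _ => rfl), Fin.prod_univ_add]
      rfl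
    have hdegA : A.natDegree ≤ 2 ^ K := by
      refine (natDegree_prod_le _ _).trans ?_
      calc ∑ b : Fin (2 ^ K), (Q (lo b)).natDegree ≤ ∑ _b : Fin (2 ^ K), 1 :=
            sum_le_sum fun b _ => hdeg (lo b)
        _ = 2 ^ K := by simp
    have hdegB : B.natDegree ≤ 2 ^ K := by
      refine (natDegree_prod_le _ _).trans ?_
      calc ∑ b : Fin (2 ^ K), (Q (hi b)).natDegree ≤ ∑ _b : Fin (2 ^ K), 1 :=
            sum_le_sum fun b _ => hdeg (hi b)
        _ = 2 ^ K := by simp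
    -- the two subtrees
    have hv1 := jointlyComputed_prodTree ζ tinv hζ ht K v s (fun b => Q (lo b))
      (fun b => e₀ (lo b)) (fun b => e₁ (lo b)) hv (fun b => hdeg _) (fun b => h₀ _) (fun b => h₁ _)
    have hv2 := jointlyComputed_prodTree ζ tinv hζ ht K _ _ (fun b => Q (hi b))
      (fun b => Sum.inl (e₀ (hi b))) (fun b => Sum.inl (e₁ (hi b))) hv1 (fun b => hdeg _)
      (fun b => by simp [h₀]) (fun b => by simp [h₁])
    -- one fast multiplication of the two half products
    have hab : (2 ^ K + 1) + (2 ^ K + 1) ≤ 2 ^ (K + 2) + 1 := by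
      have h4 : 2 ^ (K + 2) = 2 ^ K * 4 := by rw [pow_add]; norm_num
      have h1 : 1 ≤ 2 ^ K := Nat.one_le_two_pow
      rw [h4]; omega
    have hv3 := jointlyComputed_lconv hv2 (κ := K + 2) (Nat.succ_ne_zero _)
      (hζ (K + 2) (Nat.succ_ne_zero _)) (ht (K + 2))
      (fun i => A.coeff i) (fun j => B.coeff j) (la := 2 ^ K + 1) (lb := 2 ^ K + 1)
      (fun i hi => coeff_eq_zero_of_natDegree_lt (by omega))
      (fun j hj => coeff_eq_zero_of_natDegree_lt (by omega)) hab
      (fun i => Sum.inl (Sum.inr i)) (fun j => Sum.inr j) (fun i => rfl) (fun j => rfl)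
    have hcost : s + prodTreeCost K + prodTreeCost K + (3 * (K + 2) + 2) * 2 ^ (K + 2) =
        s + prodTreeCost (K + 1) := by
      rw [prodTreeCost]; ring
    rw [hcost] at hv3
    refine hv3.of_mem _ ?_
    rintro (i | m)
    · exact Or.inl ⟨Sum.inl (Sum.inl (Sum.inl i)), rfl⟩
    · have hm2 : (m : ℕ) < 2 ^ (K + 2) := by
        have h1 := m.isLt
        have h2 : 2 ^ (K + 1) < 2 ^ (K + 2) := Nat.pow_lt_pow_right (by norm_num) (by omega)
        omega
      refine Or.inl ⟨Sum.inr ⟨m, hm2⟩, ?_⟩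
      simp only [Sum.elim_inr]
      rw [hprod, ← lconv_coeff_eq_coeff_mul]

/-- **All coefficients of a product of `n` linear polynomials over the node ring** (e.g. all
elementary symmetric polynomials `e_1, …, e_n` of `n` nodes, GG §10.1) in
`prodTreeCost K ≤ 16 K² 2^K` gates for any `K` with `n ≤ 2^K` (pad with the constant polynomial
`1`): if `c₀ l`, `c₁ l` (`l < n`) are read off a jointly computed family within `s` gates, then so
are the `n + 1` coefficients of `∏_l (C (c₁ l) X + C (c₀ l))` within `s + prodTreeCost K`.
[cite: GathenGerhard2013, §10.1 Lemma 10.4] -/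
theorem jointlyComputed_prod_linear (ζ tinv : ℕ → k)
    (hζ : ∀ κ, κ ≠ 0 → ζ κ ^ 2 ^ (κ - 1) = -1) (ht : ∀ κ, (2 ^ κ : k) * tinv κ = 1)
    {ι : Type ww} {v : ι → MvPolynomial τ k} {s : ℕ} (hv : JointlyComputed v s)
    {n K : ℕ} (hK : n ≤ 2 ^ K) (c₀ c₁ : Fin n → MvPolynomial τ k) (e₀ e₁ : Fin n → ι)
    (h₀ : ∀ l, v (e₀ l) = c₀ l) (h₁ : ∀ l, v (e₁ l) = c₁ l) :
    JointlyComputed (Sum.elim v (fun m : Fin (n + 1) =>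
      (∏ l : Fin n, (Polynomial.C (c₁ l) * Polynomial.X + Polynomial.C (c₀ l))).coeff m))
      (s + prodTreeCost K) := by
  classical
  -- the padded family of linear polynomials
  let L : Fin n → (MvPolynomial τ k)[X] := fun l =>
    Polynomial.C (c₁ l) * Polynomial.X + Polynomial.C (c₀ l)
  let q : ℕ → (MvPolynomial τ k)[X] := fun i => if h : i < n then L ⟨i, h⟩ else 1
  let Q : Fin (2 ^ K) → (MvPolynomial τ k)[X] := fun b => q b
  -- the family with the constants `0`, `1` added
  let w : ι ⊕ Fin 2 → MvPolynomial τ k := Sum.elim v (fun j => if j = 0 then 0 else 1)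
  have hw : JointlyComputed w s := by
    refine hv.of_mem _ ?_
    rintro (i | j)
    · exact Or.inl ⟨i, rfl⟩
    · refine Or.inr (Or.inr ?_)
      by_cases hj : j = 0
      · exact ⟨0, by simp [w, hj]⟩
      · exact ⟨1, by simp [w, hj]⟩
  have hQdeg : ∀ b, (Q b).natDegree ≤ 1 := by
    intro b
    simp only [Q, q]
    split_ifs
    · exact natDegree_linear_le
    · simp
  let E₀ : Fin (2 ^ K) → ι ⊕ Fin 2 := fun b =>
    if h : (b : ℕ) < n then Sum.inl (e₀ ⟨b, h⟩) else Sum.inr 1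
  let E₁ : Fin (2 ^ K) → ι ⊕ Fin 2 := fun b =>
    if h : (b : ℕ) < n then Sum.inl (e₁ ⟨b, h⟩) else Sum.inr 0
  have hE₀ : ∀ b, w (E₀ b) = (Q b).coeff 0 := by
    intro b
    simp only [E₀, Q, q]
    split_ifs with h
    · simp [w, h₀, L]
    · simp [w]
  have hE₁ : ∀ b, w (E₁ b) = (Q b).coeff 1 := by
    intro b
    simp only [E₁, Q, q]
    split_ifs with h
    · simp [w, h₁, L]
    · simp [w, Polynomial.coeff_one]
  have htree := jointlyComputed_prodTree ζ tinv hζ ht K w s Q E₀ E₁ hw hQdeg hE₀ hE₁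
  -- the padded product is the product of the `L l`
  have hprod : (∏ b, Q b) = ∏ l, L l := by
    have h1 : (∏ b : Fin (2 ^ K), Q b) = ∏ i ∈ range (2 ^ K), q i :=
      Fin.prod_univ_eq_prod_range q (2 ^ K)
    have h2 : (∏ l : Fin n, L l) = ∏ i ∈ range n, q i := by
      rw [← Fin.prod_univ_eq_prod_range q n]
      exact Finset.prod_congr rfl fun l _ => by simp [q, l.isLt]
    rw [h1, h2]
    refine (Finset.prod_subset (range_subset_range.2 hK) fun i _ hi => ?_).symm
    simp only [mem_range, not_lt] at hi
    simp [q, not_lt.2 hi]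
  refine htree.of_mem _ ?_
  rintro (i | m)
  · exact Or.inl ⟨Sum.inl (Sum.inl i), rfl⟩
  · refine Or.inl ⟨Sum.inr ⟨m, by omega⟩, ?_⟩
    simp only [Sum.elim_inr]
    rw [hprod]

end ProductTree

end Literature.Computability.AlgebraicComplexity

namespace Literature.Computability.AlgebraicComplexity

/-! ### Newton iteration for the inverse square root of a power series, as a circuit -/

section NewtonRSqrt

universe uu vv ww

variable {k : Type uu} [CommRing k] {τ : Type vv}

open _root_.Finset _root_.PowerSeries

/-- `lconv` reads its arguments only up to the output index. [folklore] -/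
private theorem lconv_congr_le {S : Type*} [CommSemiring S] {a a' b b' : ℕ → S} {m : ℕ}
    (ha : ∀ i ≤ m, a i = a' i) (hb : ∀ j ≤ m, b j = b' j) : lconv a b m = lconv a' b' m := by
  unfold lconv
  refine sum_congr rfl fun ij hij => ?_
  rw [Finset.HasAntidiagonal.mem_antidiagonal] at hij
  rw [ha ij.1 (by omega), hb ij.2 (by omega)]

/-- The linear convolution of coefficient sequences of power series is the coefficient sequence
of the product. [folklore] -/
private theorem lconv_coeff_eq_coeff_mul' {S : Type*} [CommSemiring S] (φ ψ : S⟦X⟧) (m : ℕ) :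
    lconv (fun i => coeff i φ) (fun j => coeff j ψ) m = coeff m (φ * ψ) := by
  rw [PowerSeries.coeff_mul]; rfl

/-- **The Newton step for `P^{-1/2}` doubles the precision** (GG §9.1, Newton iteration; here for
the equation `P y² = 1`): if `ρ² P = 1` and `R ≡ ρ (mod X^M)`, then
`(3R − P R³)/2 ≡ ρ (mod X^{2M})`, i.e. `coeff_m (3R − P R³) = 2 coeff_m ρ` for `m < 2M` — because
`3R − PR³ − 2ρ = −(R − ρ)² (3Pρ + P(R − ρ))`. [cite: GathenGerhard2013, §9.1 Thm 9.2] -/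
theorem coeff_newton_rsqrt {S : Type*} [CommRing S] (ρ P R : S⟦X⟧) (M : ℕ)
    (hρ : ρ * ρ * P = 1) (hR : ∀ j < M, coeff j R = coeff j ρ) {m : ℕ} (hm : m < 2 * M) :
    coeff m (3 * R - P * R ^ 3) = 2 * coeff m ρ := by
  have hδ : (PowerSeries.X : S⟦X⟧) ^ M ∣ R - ρ := by
    rw [PowerSeries.X_pow_dvd_iff]
    intro j hj
    rw [map_sub, hR j hj, sub_self]
  obtain ⟨E, hE⟩ := hδ
  have key : 3 * R - P * R ^ 3 - 2 * ρ = -((R - ρ) ^ 2 * (3 * P * ρ + P * (R - ρ))) := by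
    linear_combination (2 * ρ - 3 * R) * hρ
  have hdiv : (PowerSeries.X : S⟦X⟧) ^ (2 * M) ∣ 3 * R - P * R ^ 3 - 2 * ρ := by
    rw [key, hE, show (PowerSeries.X ^ M * E) ^ 2 * (3 * P * ρ + P * (PowerSeries.X ^ M * E)) =
      PowerSeries.X ^ (2 * M) * (E ^ 2 * (3 * P * ρ + P * (PowerSeries.X ^ M * E))) by ring]
    exact (dvd_mul_right _ _).neg_right
  have h0 := (PowerSeries.X_pow_dvd_iff.mp hdiv) m hm
  rw [map_sub, sub_eq_zero] at h0
  rw [h0, two_mul, map_add, two_mul]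

/-- **One Newton step for `P^{-1/2}` as a circuit** (GG §9.1 with fast multiplication, cost
part; Bürgisser's model): if the coefficients of `P` (a polynomial of degree `≤ N` over the node
ring, as a power series) and the first `2^i` coefficients of `ρ = P^{-1/2}` (`ρ² P = 1`) are read
off a jointly computed family within `s` gates, then so are the first `2^{i+1}` coefficients of
`ρ` within `s + (15 i + 38) · 2^{i+1}` gates: three fast multiplications (`jointlyComputed_lconv`,
transform lengths `2^{i+1}, 2^{i+2}, 2^{i+2}`) and `2^{i+1}` weighted additions
`(3/2) r_m − (1/2) w_m` (`coeff_newton_rsqrt`). [cite: GathenGerhard2013, §9.1 Thm 9.4] -/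
theorem jointlyComputed_newton_step (ζ tinv : ℕ → k)
    (hζ : ∀ κ, κ ≠ 0 → ζ κ ^ 2 ^ (κ - 1) = -1) (ht : ∀ κ, (2 ^ κ : k) * tinv κ = 1)
    (half : k) (hhalf : (2 : k) * half = 1)
    {ι : Type ww} {v : ι → MvPolynomial τ k} {s : ℕ} (hv : JointlyComputed v s)
    (ρ P : (MvPolynomial τ k)⟦X⟧) (hρ : ρ * ρ * P = 1) (N : ℕ)
    (hP : ∀ j, N < j → coeff j P = 0) (eP : Fin (N + 1) → ι) (heP : ∀ j, v (eP j) = coeff j P)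
    (i : ℕ) (er : Fin (2 ^ i) → ι) (her : ∀ j, v (er j) = coeff j ρ) :
    JointlyComputed (Sum.elim v (fun m : Fin (2 ^ (i + 1)) => coeff m ρ))
      (s + (15 * i + 38) * 2 ^ (i + 1)) := by
  classical
  have h2M : 2 ^ (i + 1) = 2 * 2 ^ i := by rw [pow_succ, mul_comm]
  have h4M : 2 ^ (i + 2) = 4 * 2 ^ i := by rw [pow_add]; ring
  have hMpos : 0 < 2 ^ i := Nat.two_pow_pos i
  -- the truncation `R` of `ρ` and its coefficient sequence `r`
  let r : ℕ → MvPolynomial τ k := fun m => if m < 2 ^ i then coeff m ρ else 0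
  let R : (MvPolynomial τ k)⟦X⟧ := PowerSeries.mk r
  have hRc : ∀ m, coeff m R = r m := fun m => PowerSeries.coeff_mk _ _
  have hR : ∀ j < 2 ^ i, coeff j R = coeff j ρ := fun j hj => by rw [hRc]; exact if_pos hj
  have hr0 : ∀ m, 2 ^ i ≤ m → r m = 0 := fun m hm => if_neg (not_lt.2 hm)
  have her' : ∀ j : Fin (2 ^ i), v (er j) = r j := fun j => by
    rw [her]; exact (if_pos j.isLt).symm
  -- step 1: `u = r ∗ r` (transform length `2^{i+1}`)
  have h1 := jointlyComputed_lconv hv (κ := i + 1) (Nat.succ_ne_zero _)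
    (hζ _ (Nat.succ_ne_zero _)) (ht _) r r hr0 hr0 (by rw [h2M]; omega) er er her' her'
  set u : ℕ → MvPolynomial τ k := lconv r r with hu
  have hu' : ∀ m, u m = coeff m (R * R) := fun m => by
    rw [hu, ← lconv_coeff_eq_coeff_mul']
    simp only [hRc]
  -- step 2: `vv = P' ∗ u'` with the truncations below `2^{i+1}` (transform length `2^{i+2}`)
  let P' : ℕ → MvPolynomial τ k := fun j => if j < 2 ^ (i + 1) then coeff j P else 0
  let u' : ℕ → MvPolynomial τ k := fun j => if j < 2 ^ (i + 1) then u j else 0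
  let w₁ : (ι ⊕ Fin (2 ^ (i + 1))) ⊕ Fin (2 ^ (i + 1)) → MvPolynomial τ k :=
    Sum.elim (Sum.elim v (fun m : Fin (2 ^ (i + 1)) => u m)) (fun j => P' j)
  have hw₁ : JointlyComputed w₁ (s + (3 * (i + 1) + 2) * 2 ^ (i + 1)) := by
    refine h1.of_mem _ ?_
    rintro (x | j)
    · exact Or.inl ⟨x, rfl⟩
    · by_cases hj : (j : ℕ) ≤ N
      · refine Or.inl ⟨Sum.inl (eP ⟨j, by omega⟩), ?_⟩
        simp [w₁, P', heP]
      · refine Or.inr (Or.inr ⟨0, ?_⟩)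
        simp [w₁, P', hP j (by omega)]
  have h2 := jointlyComputed_lconv hw₁ (κ := i + 2) (Nat.succ_ne_zero _)
    (hζ _ (Nat.succ_ne_zero _)) (ht _) P' u' (la := 2 ^ (i + 1)) (lb := 2 ^ (i + 1))
    (fun j hj => if_neg (by omega)) (fun j hj => if_neg (by omega)) (by rw [h4M, h2M]; omega)
    (fun j => Sum.inr j) (fun j => Sum.inl (Sum.inr j))
    (fun j => rfl) (fun j => by simp [w₁, u', j.isLt])
  set vv : ℕ → MvPolynomial τ k := lconv P' u' with hvv
  have hvv' : ∀ m < 2 ^ (i + 1), vv m = coeff m (P * (R * R)) := by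
    intro m hm
    rw [hvv, ← lconv_coeff_eq_coeff_mul']
    exact lconv_congr_le (fun j hj => if_pos (by omega))
      (fun j hj => by simp only [u']; rw [if_pos (by omega), hu'])
  -- step 3: `w = r ∗ vv'` (transform length `2^{i+2}`)
  let vv' : ℕ → MvPolynomial τ k := fun j => if j < 2 ^ (i + 1) then vv j else 0
  have h3 := jointlyComputed_lconv h2 (κ := i + 2) (Nat.succ_ne_zero _)
    (hζ _ (Nat.succ_ne_zero _)) (ht _) r vv' (la := 2 ^ i) (lb := 2 ^ (i + 1)) hr0
    (fun j hj => if_neg (by omega)) (by rw [h4M, h2M]; omega)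
    (fun j => Sum.inl (Sum.inl (Sum.inl (er j))))
    (fun j => Sum.inr ⟨j, by have h1 : (j : ℕ) < 2 ^ (i + 1) := j.isLt; omega⟩)
    (fun j => by simp [w₁, her'])
    (fun j => by simp [vv', j.isLt])
  set w : ℕ → MvPolynomial τ k := lconv r vv' with hw
  have hw' : ∀ m < 2 ^ (i + 1), w m = coeff m (R * (P * (R * R))) := by
    intro m hm
    rw [hw, ← lconv_coeff_eq_coeff_mul']
    exact lconv_congr_le (fun j _ => (hRc j).symm)
      (fun j hj => by simp only [vv']; rw [if_pos (by omega), hvv' j (by omega)])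
  -- step 4: the weighted additions `(3/2) r_m − (1/2) w_m`
  let w₂ : ((((ι ⊕ Fin (2 ^ (i + 1))) ⊕ Fin (2 ^ (i + 1))) ⊕ Fin (2 ^ (i + 2))) ⊕
      Fin (2 ^ (i + 2))) ⊕ (Fin (2 ^ (i + 1)) ⊕ Fin (2 ^ (i + 1))) → MvPolynomial τ k :=
    Sum.elim (Sum.elim (Sum.elim w₁ (fun m : Fin (2 ^ (i + 2)) => vv m))
      (fun m : Fin (2 ^ (i + 2)) => w m))
      (Sum.elim (fun m : Fin (2 ^ (i + 1)) => r m) (fun m : Fin (2 ^ (i + 1)) => w m))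
  have hw₂ : JointlyComputed w₂ (s + (3 * (i + 1) + 2) * 2 ^ (i + 1) +
      (3 * (i + 2) + 2) * 2 ^ (i + 2) + (3 * (i + 2) + 2) * 2 ^ (i + 2)) := by
    refine h3.of_mem _ ?_
    rintro (x | (m | m))
    · exact Or.inl ⟨x, rfl⟩
    · by_cases hm : (m : ℕ) < 2 ^ i
      · refine Or.inl ⟨Sum.inl (Sum.inl (Sum.inl (Sum.inl (er ⟨m, hm⟩)))), ?_⟩
        simp [w₂, w₁, her']
      · exact Or.inr (Or.inr ⟨0, by simp [w₂, r, hm]⟩)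
    · refine Or.inl ⟨Sum.inr ⟨m, by have h1 : (m : ℕ) < 2 ^ (i + 1) := m.isLt; omega⟩, ?_⟩
      simp [w₂]
  have h4 := hw₂.extend_wadd (κ := Fin (2 ^ (i + 1))) (fun _ => 3 * half) (fun _ => -half)
    (fun m => Sum.inr (Sum.inl m)) (fun m => Sum.inr (Sum.inr m))
  rw [Fintype.card_fin] at h4
  have hcost : s + (3 * (i + 1) + 2) * 2 ^ (i + 1) + (3 * (i + 2) + 2) * 2 ^ (i + 2) +
      (3 * (i + 2) + 2) * 2 ^ (i + 2) + 2 ^ (i + 1) = s + (15 * i + 38) * 2 ^ (i + 1) := by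
    rw [h4M, h2M]; ring
  rw [hcost] at h4
  refine h4.of_mem _ ?_
  rintro (x | m)
  · exact Or.inl ⟨Sum.inl (Sum.inl (Sum.inl (Sum.inl (Sum.inl (Sum.inl x))))), rfl⟩
  · have hm : (m : ℕ) < 2 ^ (i + 1) := m.isLt
    refine Or.inl ⟨Sum.inr m, ?_⟩
    simp only [Sum.elim_inr, w₂, Sum.elim_inl]
    rw [hw' m hm, ← hRc m, MvPolynomial.smul_eq_C_mul, MvPolynomial.smul_eq_C_mul]
    have key := coeff_newton_rsqrt ρ P R (2 ^ i) hρ hR (m := m) (by omega)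
    rw [show P * R ^ 3 = R * (P * (R * R)) by ring, map_sub] at key
    have h3R : (coeff m) (3 * R) = 3 * coeff m R := by
      rw [show (3 : (MvPolynomial τ k)⟦X⟧) * R = R + R + R by ring, map_add, map_add]; ring
    rw [h3R] at key
    have hC : (MvPolynomial.C (3 * half) : MvPolynomial τ k) * coeff m R +
        MvPolynomial.C (-half) * coeff m (R * (P * (R * R))) =
        MvPolynomial.C half * (3 * coeff m R - coeff m (R * (P * (R * R)))) := by
      rw [MvPolynomial.C_mul, MvPolynomial.C_neg,
        show (MvPolynomial.C (3 : k) : MvPolynomial τ k) = 3 from map_ofNat _ _]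
      ring
    rw [hC, key, ← mul_assoc, show (2 : MvPolynomial τ k) = MvPolynomial.C 2 from
        (map_ofNat _ _).symm,
      ← MvPolynomial.C_mul, mul_comm half, hhalf, MvPolynomial.C_1, one_mul]

/-- Gate count of `J` Newton steps for `P^{-1/2}` from precision `1` to `2^J`.
[cite: GathenGerhard2013, §9.1 Thm 9.4] -/
def newtonCost : ℕ → ℕ
  | 0 => 0
  | J + 1 => newtonCost J + (15 * J + 38) * 2 ^ (J + 1)

/-- `newtonCost J ≤ (15 J + 38) 2^{J+1}` (geometric sum). [cite: GathenGerhard2013, §9.1 Thm 9.4] -/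
theorem newtonCost_le (J : ℕ) : newtonCost J ≤ (15 * J + 38) * 2 ^ (J + 1) := by
  induction J with
  | zero => simp [newtonCost]
  | succ J ih =>
    rw [newtonCost, show (15 * (J + 1) + 38) * 2 ^ (J + 1 + 1) =
      2 * ((15 * J + 38) * 2 ^ (J + 1)) + 30 * 2 ^ (J + 1) by ring]
    omega

/-- **Newton iteration for `P^{-1/2}` as a circuit** (GG §9.1, cost with fast multiplication):
the first `2^J` coefficients of `ρ` (`ρ² P = 1`, `ρ(0) = 1`, `P` a polynomial of degree `≤ N` over
the node ring whose coefficients are read off the family) are jointly computed within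
`newtonCost J ≤ (15 J + 38) 2^{J+1}` further gates. [cite: GathenGerhard2013, §9.1 Thm 9.4] -/
theorem jointlyComputed_newton (ζ tinv : ℕ → k)
    (hζ : ∀ κ, κ ≠ 0 → ζ κ ^ 2 ^ (κ - 1) = -1) (ht : ∀ κ, (2 ^ κ : k) * tinv κ = 1)
    (half : k) (hhalf : (2 : k) * half = 1)
    (ρ P : (MvPolynomial τ k)⟦X⟧) (hρ : ρ * ρ * P = 1) (hρ0 : coeff 0 ρ = 1) (N : ℕ)
    (hP : ∀ j, N < j → coeff j P = 0) :
    ∀ (J : ℕ) {ι : Type ww} (v : ι → MvPolynomial τ k) (s : ℕ) (eP : Fin (N + 1) → ι),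
      JointlyComputed v s → (∀ j, v (eP j) = coeff j P) →
      JointlyComputed (Sum.elim v (fun m : Fin (2 ^ J) => coeff m ρ)) (s + newtonCost J)
  | 0, ι, v, s, eP, hv, heP => by
    rw [newtonCost, Nat.add_zero]
    refine hv.of_mem _ ?_
    rintro (x | m)
    · exact Or.inl ⟨x, rfl⟩
    · refine Or.inr (Or.inr ⟨1, ?_⟩)
      simp [hρ0]
  | J + 1, ι, v, s, eP, hv, heP => by
    have ih := jointlyComputed_newton ζ tinv hζ ht half hhalf ρ P hρ hρ0 N hP J v s eP hv heP
    have hstep := jointlyComputed_newton_step ζ tinv hζ ht half hhalf ih ρ P hρ N hP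
      (fun j => Sum.inl (eP j)) (fun j => by simp [heP]) J (fun j => Sum.inr j) (fun j => rfl)
    rw [newtonCost, ← Nat.add_assoc]
    refine hstep.of_mem _ ?_
    rintro (x | m)
    · exact Or.inl ⟨Sum.inl (Sum.inl x), rfl⟩
    · exact Or.inl ⟨Sum.inr m, rfl⟩

/-- **Partial sums**: the sum of `m + 1` members costs `m` gates. [cite: Burgisser2000, Def. 2.1] -/
theorem jointlyComputed_sum {ι : Type ww} {v : ι → MvPolynomial τ k} {s : ℕ}
    (hv : JointlyComputed v s) (t : ℕ → MvPolynomial τ k) :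
    ∀ (m : ℕ) (et : Fin (m + 1) → ι), (∀ j, v (et j) = t j) →
      JointlyComputed (Sum.elim v (fun _ : Unit => ∑ j ∈ range (m + 1), t j)) (s + m)
  | 0, et, het => by
    rw [Nat.add_zero]
    refine hv.of_mem _ ?_
    rintro (x | u)
    · exact Or.inl ⟨x, rfl⟩
    · exact Or.inl ⟨et 0, by simp [het]⟩
  | m + 1, et, het => by
    have ih := jointlyComputed_sum hv t m (fun j => et (Fin.castSucc j)) (fun j => by
      rw [het]; rfl)
    have h1 := ih.extend_wadd (κ := Unit) (fun _ => (1 : k)) (fun _ => (1 : k))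
      (fun _ => Sum.inr ()) (fun _ => Sum.inl (et (Fin.last (m + 1))))
    rw [Fintype.card_unit, Nat.add_assoc] at h1
    refine h1.of_mem _ ?_
    rintro (x | u)
    · exact Or.inl ⟨Sum.inl (Sum.inl x), rfl⟩
    · refine Or.inl ⟨Sum.inr (), ?_⟩
      simp only [Sum.elim_inr, Sum.elim_inl, one_smul, het]
      rw [sum_range_succ]
      rfl

end NewtonRSqrt

end Literature.Computability.AlgebraicComplexity

end
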